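import Literature.Analysis.OperatorTheory.FourierLerayProjection
import Literature.Analysis.OperatorTheory.SimilarityHeatSemigroupL2
import Literature.Analysis.UnboundedOperators.StrongContRepresentationSubspace
import HarnessLib

/-!
# The similarity heat semigroup on divergence-free fields `L²_σ(V; F)` and its resolvent
  (the free part of `L_ss` in the setting of Albritton–Brué–Colombo 2022, §2.2)

Analysis/OperatorTheory file (three definitions with bodies, everything proved, no named facts):

* `lerayL2 ι := 𝓕⁻¹ ∘ ℙ̂ ∘ 𝓕` (**definition**), the Leray projection on `L²(V; F)` from the
  Fourier multiplier `fourierLeray ι` (`FourierLerayProjection.lean`) and Mathlib's Plancherel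
  isometry; `lerayL2_mul_self` (`ℙ² = ℙ`), `norm_lerayL2_apply_le` (`‖ℙ f‖ ≤ ‖f‖`),
  `commute_lerayL2_similarityHeat` (**`ℙ` commutes with `S(τ) = e^{τ(Δ + ½x·∇ + ½)}`**);
* `divFreeL2 ι := ker(1 − ℙ)` (**definition**), the closed subspace `L²_σ` of divergence-free
  fields (`isClosed_divFreeL2`, complete);
* `similarityHeatSemigroupDivFree ι : C0Semigroup ℂ (divFreeL2 ι)` (**definition**), the
  subspace semigroup `S(τ)|_{L²_σ}` (`StrongContRepresentationSubspace.lean`), with the growth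
  bound `‖S(τ)|_{L²_σ}‖ ≤ e^{(½ − d/4)τ}` and, through the Laplace bridge, its resolvent as a
  pseudo-resolvent on `{Re λ > ½ − d/4}` (`{Re λ > −¼}` for `d = 3`) whose closed operator is the
  generator: the operator `𝓛 = Δ + ½ξ·∇ + ½` on `L²_σ(ℝ³)` of [ABC] §2.2 / Jia–Šverák Lemma 2.1
  ("`A : D(A) ⊂ L²_σ → L²_σ` … `σ(A) ⊂ {Re λ ≤ −¼}`"), ready for the relatively compact
  perturbation calculus `PseudoResolventRelCompactPerturbation.lean`.

## References

* D. Albritton, E. Brué, M. Colombo, Ann. of Math. 196 (2022), §2.2 (the operators on `L²_σ`).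
  [AlbrittonBrueColombo2022AnnMath]
* H. Jia, V. Šverák, J. Funct. Anal. 268 (2015), §2 Lemma 2.1. [JiaSverak2015]
* K.-J. Engel, R. Nagel (2000), Ch. II 2.3 (subspace semigroups), Thm. II.1.10. [EngelNagel2000]
-/

noncomputable section

open MeasureTheory Filter Topology
open scoped ENNReal NNReal

namespace Literature.Analysis.OperatorTheory

open Literature.Analysis.UnboundedOperators

variable {V : Type*} [NormedAddCommGroup V] [InnerProductSpace ℝ V] [FiniteDimensional ℝ V]
  [MeasurableSpace V] [BorelSpace V]
variable {F : Type*} [NormedAddCommGroup F] [InnerProductSpace ℂ F] [CompleteSpace F]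

/-- The `L²` Fourier transform as a continuous linear equivalence (Mathlib's Plancherel
isometry). [folklore] -/
abbrev fourierCLE (V F : Type*) [NormedAddCommGroup V] [InnerProductSpace ℝ V]
    [FiniteDimensional ℝ V] [MeasurableSpace V] [BorelSpace V] [NormedAddCommGroup F]
    [InnerProductSpace ℂ F] [CompleteSpace F] :
    Lp F 2 (volume : Measure V) ≃L[ℂ] Lp F 2 (volume : Measure V) :=
  (Lp.fourierTransformₗᵢ V F).toContinuousLinearEquiv

/-- **The Leray projection on `L²(V; F)`**: `ℙ = 𝓕⁻¹ ∘ ℙ̂ ∘ 𝓕` with `ℙ̂` the multiplier by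
`1 − k⊗k/|k|²`. [cite: AlbrittonBrueColombo2022AnnMath, §2.2] -/
def lerayL2 (ι : V →L[ℝ] F) : Lp F 2 (volume : Measure V) →L[ℂ] Lp F 2 (volume : Measure V) :=
  ((fourierCLE V F).symm : Lp F 2 (volume : Measure V) →L[ℂ] Lp F 2 (volume : Measure V)).comp
    ((fourierLeray ι).comp
      ((fourierCLE V F) : Lp F 2 (volume : Measure V) →L[ℂ] Lp F 2 (volume : Measure V)))

/-- `ℙ f = 𝓕⁻¹ (ℙ̂ (𝓕 f))`. [cite: AlbrittonBrueColombo2022AnnMath, §2.2] -/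
theorem lerayL2_apply (ι : V →L[ℝ] F) (f : Lp F 2 (volume : Measure V)) :
    lerayL2 ι f = (fourierCLE V F).symm (fourierLeray ι (fourierCLE V F f)) := rfl

/-- **`ℙ² = ℙ`.** [cite: AlbrittonBrueColombo2022AnnMath, §2.2] -/
theorem lerayL2_mul_self (ι : V →L[ℝ] F) : lerayL2 ι * lerayL2 ι = lerayL2 ι := by
  ext1 f
  rw [mul_apply_eq_comp, lerayL2_apply, lerayL2_apply, ContinuousLinearEquiv.apply_symm_apply,
    ← mul_apply_eq_comp (fourierLeray ι), fourierLeray_mul_self]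

/-- **`‖ℙ f‖ ≤ ‖f‖`** (Plancherel). [cite: AlbrittonBrueColombo2022AnnMath, §2.2] -/
theorem norm_lerayL2_apply_le (ι : V →L[ℝ] F) (f : Lp F 2 (volume : Measure V)) :
    ‖lerayL2 ι f‖ ≤ ‖f‖ := by
  rw [lerayL2_apply]
  change ‖(Lp.fourierTransformₗᵢ V F).symm (fourierLeray ι (Lp.fourierTransformₗᵢ V F f))‖ ≤ ‖f‖
  rw [LinearIsometryEquiv.norm_map]
  refine (norm_fourierLeray_apply_le ι _).trans (le_of_eq ?_)
  exact (Lp.fourierTransformₗᵢ V F).norm_map f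

/-- The similarity heat semigroup through the Fourier equivalence:
`S(τ) f = 𝓕⁻¹ (M_τ (𝓕 f))`. [cite: JiaSverak2015, §2 Lemma 2.1] -/
theorem similarityHeatSemigroupL2_app_apply' (τ : ℝ≥0) (f : Lp F 2 (volume : Measure V)) :
    (similarityHeatSemigroupL2 V F).app τ f =
      (fourierCLE V F).symm (fourierSimilarityHeat two_ne_top' τ (fourierCLE V F f)) :=
  similarityHeatSemigroupL2_app_apply τ f

/-- **`ℙ` commutes with `S(τ)`** (conjugate of `ℙ̂ M_τ = M_τ ℙ̂`). [cite: AlbrittonBrueColombo2022AnnMath, §2.2] -/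
theorem commute_lerayL2_similarityHeat (ι : V →L[ℝ] F) (τ : ℝ≥0) :
    Commute (lerayL2 ι) ((similarityHeatSemigroupL2 V F).app τ) := by
  have hcomm := fourierLeray_comm_fourierSimilarityHeat (p := 2) (F := F) ι two_ne_top' τ
  refine ContinuousLinearMap.ext fun f => ?_
  show lerayL2 ι ((similarityHeatSemigroupL2 V F).app τ f) =
    (similarityHeatSemigroupL2 V F).app τ (lerayL2 ι f)
  rw [similarityHeatSemigroupL2_app_apply', similarityHeatSemigroupL2_app_apply', lerayL2_apply,
    lerayL2_apply, ContinuousLinearEquiv.apply_symm_apply, ContinuousLinearEquiv.apply_symm_apply,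
    ← mul_apply_eq_comp (fourierLeray ι), hcomm, mul_apply_eq_comp]

/-- **`L²_σ(V; F) := ker(1 − ℙ)`**, the divergence-free subspace (`= Ran ℙ`).
[cite: AlbrittonBrueColombo2022AnnMath, §2.2] -/
def divFreeL2 (ι : V →L[ℝ] F) : Submodule ℂ (Lp F 2 (volume : Measure V)) :=
  LinearMap.ker ((1 - lerayL2 ι : Lp F 2 (volume : Measure V) →L[ℂ] Lp F 2 (volume : Measure V)) :
    Lp F 2 (volume : Measure V) →ₗ[ℂ] Lp F 2 (volume : Measure V))

/-- `f ∈ L²_σ ↔ ℙ f = f`. [cite: AlbrittonBrueColombo2022AnnMath, §2.2] -/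
theorem mem_divFreeL2_iff (ι : V →L[ℝ] F) (f : Lp F 2 (volume : Measure V)) :
    f ∈ divFreeL2 ι ↔ lerayL2 ι f = f := by
  rw [divFreeL2, LinearMap.mem_ker]
  show (1 - lerayL2 ι) f = 0 ↔ _
  rw [sub_apply, one_apply_eq_self, sub_eq_zero, eq_comm]

/-- `ℙ f ∈ L²_σ`. [cite: AlbrittonBrueColombo2022AnnMath, §2.2] -/
theorem lerayL2_mem_divFreeL2 (ι : V →L[ℝ] F) (f : Lp F 2 (volume : Measure V)) :
    lerayL2 ι f ∈ divFreeL2 ι := by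
  rw [mem_divFreeL2_iff, ← mul_apply_eq_comp, lerayL2_mul_self]

/-- `L²_σ` is closed. [folklore] -/
theorem isClosed_divFreeL2 (ι : V →L[ℝ] F) : IsClosed (divFreeL2 ι : Set (Lp F 2 (volume : Measure V))) :=
  ContinuousLinearMap.isClosed_ker _

/-- `L²_σ` is complete (closed subspace of the Hilbert space `L²`). [folklore] -/
instance instCompleteSpaceDivFreeL2 (ι : V →L[ℝ] F) : CompleteSpace (divFreeL2 ι) :=
  (isClosed_divFreeL2 ι).completeSpace_coe

/-- **The similarity heat semigroup on `L²_σ`**: `S(τ)|_{L²_σ}` (subspace semigroup; `L²_σ` is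
invariant because `ℙ` commutes with `S(τ)`). [cite: AlbrittonBrueColombo2022AnnMath, §2.2] -/
def similarityHeatSemigroupDivFree (ι : V →L[ℝ] F) : C0Semigroup ℂ (divFreeL2 ι) :=
  (similarityHeatSemigroupL2 V F).subRep (divFreeL2 ι)
    (C0Semigroup.subRep_hyp_of_commute _ (commute_lerayL2_similarityHeat ι))

/-- `S(τ)|_{L²_σ} f = S(τ) f`. [cite: AlbrittonBrueColombo2022AnnMath, §2.2] -/
theorem similarityHeatSemigroupDivFree_app_coe (ι : V →L[ℝ] F) (τ : ℝ≥0) (f : divFreeL2 ι) :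
    (((similarityHeatSemigroupDivFree ι).app τ f : divFreeL2 ι) : Lp F 2 (volume : Measure V)) =
      (similarityHeatSemigroupL2 V F).app τ f := rfl

/-- **Growth bound on `L²_σ`**: `‖S(τ)|_{L²_σ}‖ ≤ 1 · e^{(½ − d/4)τ}`. [cite: JiaSverak2015, §2 Lemma 2.1] -/
theorem norm_similarityHeatSemigroupDivFree_app_le (ι : V →L[ℝ] F) (τ : ℝ≥0) :
    ‖(similarityHeatSemigroupDivFree ι).app τ‖ ≤
      1 * Real.exp ((1 / 2 - Module.finrank ℝ V / 4) * τ) :=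
  C0Semigroup.norm_subRep_app_le_of_le _ _ _ (norm_similarityHeatSemigroupL2_app_le (V := V) (F := F)) τ

/-- **The resolvent of `𝓛|_{L²_σ}` is a pseudo-resolvent on `{Re λ > ½ − d/4}`.**
[cite: JiaSverak2015, §2 Lemma 2.1; AlbrittonBrueColombo2022AnnMath §2.2] -/
theorem isPseudoResolvent_similarityHeatDivFree_resolvent (ι : V →L[ℝ] F) :
    IsPseudoResolvent {l : ℂ | 1 / 2 - (Module.finrank ℝ V : ℝ) / 4 < l.re}
      ((similarityHeatSemigroupDivFree ι).laplaceResolvent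
        (norm_similarityHeatSemigroupDivFree_app_le ι)) :=
  C0Semigroup.isPseudoResolvent_laplaceResolvent _ _

/-- … in dimension `3`: the half-plane `{Re λ > −¼}` ([ABC] §2.2 / Jia–Šverák:
`σ(𝓛|_{L²_σ}) ⊆ {Re λ ≤ −¼}`). [cite: JiaSverak2015, §2 Lemma 2.1; AlbrittonBrueColombo2022AnnMath §2.2] -/
theorem isPseudoResolvent_similarityHeatDivFree_resolvent_of_finrank_eq_three (ι : V →L[ℝ] F)
    (hV : Module.finrank ℝ V = 3) :
    IsPseudoResolvent {l : ℂ | -(1 / 4 : ℝ) < l.re}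
      ((similarityHeatSemigroupDivFree ι).laplaceResolvent
        (norm_similarityHeatSemigroupDivFree_app_le ι)) := by
  have h := isPseudoResolvent_similarityHeatDivFree_resolvent (V := V) (F := F) ι
  have hset : {l : ℂ | 1 / 2 - (Module.finrank ℝ V : ℝ) / 4 < l.re} =
      {l : ℂ | -(1 / 4 : ℝ) < l.re} := by
    ext l
    simp only [Set.mem_setOf_eq, hV, Nat.cast_ofNat]
    constructor <;> intro hl <;> linarith
  rwa [hset] at h

/-- **The closed operator of the resolvent family on `L²_σ` is the generator of `S|_{L²_σ}`**
(the operator `𝓛 : D(𝓛) ⊂ L²_σ → L²_σ` of [ABC] §2.2). [cite: EngelNagel2000, Ch. II Thm. 1.10] -/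
theorem operatorOfResolvent_similarityHeatDivFree_eq_generator (ι : V →L[ℝ] F) {z₀ : ℂ}
    (hz₀ : 1 / 2 - (Module.finrank ℝ V : ℝ) / 4 < z₀.re) :
    operatorOfResolvent ((similarityHeatSemigroupDivFree ι).laplaceResolvent
        (norm_similarityHeatSemigroupDivFree_app_le ι)) z₀
      (C0Semigroup.injective_laplaceResolvent _ _ hz₀) =
      (similarityHeatSemigroupDivFree ι).generator :=
  C0Semigroup.operatorOfResolvent_laplaceResolvent_eq_generator _ _ hz₀

end Literature.Analysis.OperatorTheory
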